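import Summits.SmoothPoincare4.SmoothPoincare4.Theorems.CylinderEntropyCylinderRungTwoHamiltonMonotonicityDivergence
import HarnessLib

/-!
# Route `CylinderEntropy`, crux `CylinderRungTwo` (stmt-SmoothPoincare4-7631), line `killing-flux`:
# the first-moment identity (registered helper `helper_firstMomentIdentity`, a first-variation
# identity consumed by the constancy step of `stub_areaQuantization`)

For a closed immersed cross-section `f : M⁴ → N = S⁴ × ℝ = {z ∈ ℝ⁶ | ∑_{i<5} zᵢ² = 1}` with smooth
unit normal `ν` tangent to `N` and mean curvature `H` (tree `meanCurvature` of `(f, ν)` in `ℝ⁶`),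
for every test function `Φ ∈ C²(ℝ)` of the height `z₅` and every horizontal coordinate `zᵢ`,
`i < 5`,

  `∫_M ( [Φ''(z₅) zᵢ - 4 Φ(z₅) zᵢ]
        - [Φ''(z₅) ν₅² zᵢ + 2 Φ'(z₅) ν₅ νᵢ - |ν'|² Φ(z₅) zᵢ]
        - H [Φ'(z₅) ν₅ zᵢ + Φ(z₅) νᵢ] ) dμ_g = 0`,   `μ_g` the Riemannian measure of `g = f^*δ`

(`|ν'|² = ∑_{l<5} ν_l²`). This is Green's identity `∫_M Δ_g(φ ∘ f) dμ_g = 0` for the FIRST-MOMENT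
test function `φ(z) = Φ(z₅) zᵢ`: we apply the landed ambient form of Green's identity
(`integral_sliceLaplacian_eq_zero`, part 3 of Hamilton's monotonicity,
`…HamiltonMonotonicityDivergence.lean`) to `φ`, for which, with `L = e₅^*`, `Lᵢ = eᵢ^*` the
coordinate functionals, `Dφ_p = Φ(p₅) Lᵢ + pᵢ Φ'(p₅) L` and
`D²φ_p(a, b) = Φ''(p₅) a₅ b₅ pᵢ + Φ'(p₅) a₅ bᵢ + Φ'(p₅) b₅ aᵢ` (Leibniz and chain rules; for
`Φ ∈ C²`, `deriv (deriv Φ)` is the genuine second derivative), so that `Δ_{ℝ⁶} φ = Φ''(z₅) zᵢ`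
(only `j = 5` survives, `(eᵢ)₅ = 0`), `D²φ(n, n) = 0` and `Dφ(n) = Φ(z₅) zᵢ` for the radial normal
`n = (z', 0)` (`n₅ = 0`, `nᵢ = zᵢ`), `D²φ(ν, ν) = Φ''(z₅) ν₅² zᵢ + 2 Φ'(z₅) ν₅ νᵢ` and
`Dφ(ν) = Φ'(z₅) ν₅ zᵢ + Φ(z₅) νᵢ`: the integrand of `integral_sliceLaplacian_eq_zero` collapses
POINTWISE to the displayed integrand, and no integrability is needed.

* `hasFDerivAt_firstMoment`, `fderiv_firstMoment`, `fderiv_firstMoment_apply`,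
  `hasFDerivAt_fderiv_firstMoment`, `iteratedFDeriv_two_firstMoment`,
  `sum_iteratedFDeriv_two_firstMoment_single`, `contDiff_firstMoment` — the calculus of
  `φ = (Φ ∘ L) · Lᵢ` (the chain rule through `L` for `Φ ∘ L`, as in `…VerticalTestIdentity.lean`,
  is re-derived in two private lemmas to keep this file independent of that one);
* `firstMoment_identity` — the identity, with implicit binders;
* `helper_firstMomentIdentity` — the registered helper, verbatim.

With `Φ ≡ 1` this is `∫_M ((4 - |ν'|²) zᵢ + H νᵢ) dμ_g = 0` (the horizontal first moments are
controlled by tilt and mean curvature), the smooth-level input of the constancy /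
`S⁴`-equidistribution step of the area-quantization argument.

Everything here is PROVED (no `sorry`, no new definitions, no named facts).

References: R. S. Hamilton, Comm. Anal. Geom. 1 (1993) 127–137, §4 (first variation on slices of
`S⁴ × ℝ`); L. Simon, *Lectures on Geometric Measure Theory* (1983), §16 (first variation,
`∫ div_M X = -∫ ⟨H⃗, X⟩`).
-/

-- the prescribed namespace `Summit.SmoothPoincare4.SmoothPoincare4.…` repeats `SmoothPoincare4`
set_option linter.dupNamespace false

noncomputable section

open Bundle Set Function Filter MeasureTheory Module
open scoped Manifold ContDiff Topology RealInnerProductSpace BigOperators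

namespace Summit.SmoothPoincare4.SmoothPoincare4.Cruxes.CylinderRungTwo.KillingFlux

open Literature.Geometry.Riemannian Literature.Geometry.Riemannian.EuclideanHypersurface
open Literature.Geometry.Lorentzian Literature.Geometry.Lorentzian.PseudoRiemannianMetric
open Literature.Geometry.Riemannian.SphericalCylinderEntropy (truncL truncL_apply)
open Literature.Geometry.Manifold.CylinderSlice (padL padL_apply_castSucc padL_apply_last
  castSucc_ne_five)

/-! ## Calculus of the first-moment test function `φ(z) = Φ(z₅) zᵢ` on `ℝ⁶` -/

section FirstMoment

variable {Φ : ℝ → ℝ}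

/-- Chain rule through the height functional: `z ↦ Ψ(z₅)` has derivative `Ψ'(p₅) · e₅^*` at `p`
for `Ψ` differentiable (as in `…VerticalTestIdentity.lean`). [folklore] -/
private theorem hasFDerivAt_heightComp {Ψ : ℝ → ℝ} (hΨ : Differentiable ℝ Ψ)
    (p : EuclideanSpace ℝ (Fin 6)) :
    HasFDerivAt (fun z : EuclideanSpace ℝ (Fin 6) => Ψ (z 5))
      ((deriv Ψ (p 5)) •
        (EuclideanSpace.proj (5 : Fin 6) : EuclideanSpace ℝ (Fin 6) →L[ℝ] ℝ)) p := by
  have h : HasDerivAt Ψ (deriv Ψ (p 5))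
      ((EuclideanSpace.proj (5 : Fin 6) : EuclideanSpace ℝ (Fin 6) →L[ℝ] ℝ) p) :=
    (hΨ _).hasDerivAt
  exact h.comp_hasFDerivAt p
    (EuclideanSpace.proj (5 : Fin 6) : EuclideanSpace ℝ (Fin 6) →L[ℝ] ℝ).hasFDerivAt

/-- `z ↦ Ψ(z₅)` is `C²` on `ℝ⁶` for `Ψ ∈ C²` (as in `…VerticalTestIdentity.lean`). [folklore] -/
private theorem contDiff_heightComp {Ψ : ℝ → ℝ} (hΨ : ContDiff ℝ 2 Ψ) :
    ContDiff ℝ 2 (fun z : EuclideanSpace ℝ (Fin 6) => Ψ (z 5)) :=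
  hΨ.comp (EuclideanSpace.proj (5 : Fin 6) : EuclideanSpace ℝ (Fin 6) →L[ℝ] ℝ).contDiff

/-- The first-moment test function `φ(z) = Φ(z₅) zᵢ` on `ℝ⁶` has derivative
`Dφ_p = Φ(p₅) eᵢ^* + pᵢ Φ'(p₅) e₅^*` for `Φ` differentiable (Leibniz rule, and the chain rule
through the coordinate functional `e₅^* = EuclideanSpace.proj 5`). [folklore] -/
theorem hasFDerivAt_firstMoment (hΦ : Differentiable ℝ Φ) (i : Fin 5)
    (p : EuclideanSpace ℝ (Fin 6)) :
    HasFDerivAt (fun z : EuclideanSpace ℝ (Fin 6) => Φ (z 5) * z (Fin.castSucc i))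
      ((Φ (p 5)) • (EuclideanSpace.proj (Fin.castSucc i) : EuclideanSpace ℝ (Fin 6) →L[ℝ] ℝ)
        + (p (Fin.castSucc i)) • ((deriv Φ (p 5)) •
          (EuclideanSpace.proj (5 : Fin 6) : EuclideanSpace ℝ (Fin 6) →L[ℝ] ℝ))) p :=
  (hasFDerivAt_heightComp hΦ p).fun_mul
    (EuclideanSpace.proj (Fin.castSucc i) : EuclideanSpace ℝ (Fin 6) →L[ℝ] ℝ).hasFDerivAt

/-- `Dφ = (p ↦ Φ(p₅) eᵢ^* + (pᵢ Φ'(p₅)) e₅^*)` for `Φ` differentiable. [folklore] -/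
theorem fderiv_firstMoment (hΦ : Differentiable ℝ Φ) (i : Fin 5) :
    fderiv ℝ (fun z : EuclideanSpace ℝ (Fin 6) => Φ (z 5) * z (Fin.castSucc i)) = fun p =>
      (Φ (p 5)) • (EuclideanSpace.proj (Fin.castSucc i) : EuclideanSpace ℝ (Fin 6) →L[ℝ] ℝ)
        + (p (Fin.castSucc i) * deriv Φ (p 5)) •
          (EuclideanSpace.proj (5 : Fin 6) : EuclideanSpace ℝ (Fin 6) →L[ℝ] ℝ) :=
  funext fun p => by rw [(hasFDerivAt_firstMoment hΦ i p).fderiv, smul_smul]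

/-- `Dφ_p(a) = Φ'(p₅) a₅ pᵢ + Φ(p₅) aᵢ` for `Φ` differentiable. [folklore] -/
theorem fderiv_firstMoment_apply (hΦ : Differentiable ℝ Φ) (i : Fin 5)
    (p a : EuclideanSpace ℝ (Fin 6)) :
    fderiv ℝ (fun z : EuclideanSpace ℝ (Fin 6) => Φ (z 5) * z (Fin.castSucc i)) p a =
      deriv Φ (p 5) * a 5 * p (Fin.castSucc i) + Φ (p 5) * a (Fin.castSucc i) := by
  rw [(hasFDerivAt_firstMoment hΦ i p).fderiv, add_apply, smul_apply,
    smul_apply, smul_apply, smul_eq_mul, smul_eq_mul, smul_eq_mul, PiLp.proj_apply, PiLp.proj_apply]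
  ring

/-- `D(Dφ)_p = (Φ'(p₅) e₅^*) ⊗ eᵢ^* + (pᵢ Φ''(p₅) e₅^* + Φ'(p₅) eᵢ^*) ⊗ e₅^*` for `Φ ∈ C²`:
`Dφ = (Φ ∘ e₅^*) eᵢ^* + (eᵢ^* · (Φ' ∘ e₅^*)) e₅^*` with `Φ`, `Φ'` differentiable
(`ContDiff.differentiable_deriv_two`), and `deriv (deriv Φ)` is then the genuine second
derivative. [folklore] -/
theorem hasFDerivAt_fderiv_firstMoment (hΦ : ContDiff ℝ 2 Φ) (i : Fin 5)
    (p : EuclideanSpace ℝ (Fin 6)) :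
    HasFDerivAt (fderiv ℝ (fun z : EuclideanSpace ℝ (Fin 6) => Φ (z 5) * z (Fin.castSucc i)))
      ((((deriv Φ (p 5)) •
            (EuclideanSpace.proj (5 : Fin 6) : EuclideanSpace ℝ (Fin 6) →L[ℝ] ℝ)).smulRight
          (EuclideanSpace.proj (Fin.castSucc i) : EuclideanSpace ℝ (Fin 6) →L[ℝ] ℝ))
        + (((p (Fin.castSucc i)) • ((deriv (deriv Φ) (p 5)) •
              (EuclideanSpace.proj (5 : Fin 6) : EuclideanSpace ℝ (Fin 6) →L[ℝ] ℝ))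
            + (deriv Φ (p 5)) •
              (EuclideanSpace.proj (Fin.castSucc i) : EuclideanSpace ℝ (Fin 6) →L[ℝ] ℝ)).smulRight
          (EuclideanSpace.proj (5 : Fin 6) : EuclideanSpace ℝ (Fin 6) →L[ℝ] ℝ))) p := by
  rw [fderiv_firstMoment (hΦ.differentiable two_ne_zero)]
  refine ((hasFDerivAt_heightComp (hΦ.differentiable two_ne_zero) p).smul_const
    (EuclideanSpace.proj (Fin.castSucc i) : EuclideanSpace ℝ (Fin 6) →L[ℝ] ℝ)).add ?_
  exact (((EuclideanSpace.proj (Fin.castSucc i) :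
      EuclideanSpace ℝ (Fin 6) →L[ℝ] ℝ).hasFDerivAt).fun_mul
    (hasFDerivAt_heightComp hΦ.differentiable_deriv_two p)).smul_const
    (EuclideanSpace.proj (5 : Fin 6) : EuclideanSpace ℝ (Fin 6) →L[ℝ] ℝ)

/-- `D²φ_p(a, b) = Φ''(p₅) a₅ b₅ pᵢ + Φ'(p₅) a₅ bᵢ + Φ'(p₅) b₅ aᵢ` for `Φ ∈ C²`. [folklore] -/
theorem iteratedFDeriv_two_firstMoment (hΦ : ContDiff ℝ 2 Φ) (i : Fin 5)
    (p a b : EuclideanSpace ℝ (Fin 6)) :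
    iteratedFDeriv ℝ 2 (fun z : EuclideanSpace ℝ (Fin 6) => Φ (z 5) * z (Fin.castSucc i)) p
        ![a, b] =
      deriv (deriv Φ) (p 5) * a 5 * b 5 * p (Fin.castSucc i)
        + deriv Φ (p 5) * a 5 * b (Fin.castSucc i) + deriv Φ (p 5) * b 5 * a (Fin.castSucc i) := by
  rw [iteratedFDeriv_two_apply, (hasFDerivAt_fderiv_firstMoment hΦ i p).fderiv]
  simp only [Matrix.cons_val_zero, Matrix.cons_val_one, add_apply,
    ContinuousLinearMap.smulRight_apply, smul_apply, smul_eq_mul, PiLp.proj_apply]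
  ring

/-- `φ(z) = Φ(z₅) zᵢ` is `C²` for `Φ ∈ C²`. [folklore] -/
theorem contDiff_firstMoment (hΦ : ContDiff ℝ 2 Φ) (i : Fin 5) :
    ContDiff ℝ 2 (fun z : EuclideanSpace ℝ (Fin 6) => Φ (z 5) * z (Fin.castSucc i)) :=
  (contDiff_heightComp hΦ).mul
    (EuclideanSpace.proj (Fin.castSucc i) : EuclideanSpace ℝ (Fin 6) →L[ℝ] ℝ).contDiff

/-- `Δ_{ℝ⁶} φ = ∑ⱼ D²φ(eⱼ, eⱼ) = Φ''(z₅) zᵢ` (only `j = 5` contributes: `(eⱼ)₅ = 0` for `j ≠ 5` and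
`(e₅)ᵢ = 0`). [folklore] -/
theorem sum_iteratedFDeriv_two_firstMoment_single (hΦ : ContDiff ℝ 2 Φ) (i : Fin 5)
    (p : EuclideanSpace ℝ (Fin 6)) :
    ∑ j : Fin 6, iteratedFDeriv ℝ 2
        (fun z : EuclideanSpace ℝ (Fin 6) => Φ (z 5) * z (Fin.castSucc i)) p
        ![EuclideanSpace.single j (1 : ℝ), EuclideanSpace.single j (1 : ℝ)] =
      deriv (deriv Φ) (p 5) * p (Fin.castSucc i) := by
  simp only [iteratedFDeriv_two_firstMoment hΦ, PiLp.single_apply, Fin.sum_univ_six]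
  simp [castSucc_ne_five i]

end FirstMoment

/-! ## The first-moment identity -/

section Identity

variable {M : Type*} [TopologicalSpace M] [ChartedSpace (EuclideanSpace ℝ (Fin 4)) M]
  [IsManifold (𝓡 4) ∞ M] [CompactSpace M] [T2Space M] [MeasurableSpace M] [BorelSpace M]

/-- **The first-moment identity** for a closed immersed cross-section `f : M⁴ → N = S⁴ × ℝ ⊂ ℝ⁶`
with smooth unit normal `ν` tangent to `N`, mean curvature `H` of `(f, ν)`, `g = f^*δ`, any
`Φ ∈ C²(ℝ)` and `i < 5`:
`∫_M ([Φ''zᵢ - 4Φzᵢ] - [Φ''ν₅²zᵢ + 2Φ'ν₅νᵢ - |ν'|²Φzᵢ] - H[Φ'ν₅zᵢ + Φνᵢ]) dμ_g = 0`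
(`Φ, Φ', Φ''` at `z₅`): Green's identity `∫_M Δ_g(φ ∘ f) dμ_g = 0` in ambient terms
(`integral_sliceLaplacian_eq_zero`) for `φ(z) = Φ(z₅) zᵢ`, whose integrand is the displayed one
pointwise (`Dφ_p(a) = Φ'(p₅)a₅pᵢ + Φ(p₅)aᵢ`, `D²φ_p(a,b) = Φ''(p₅)a₅b₅pᵢ + Φ'(p₅)(a₅bᵢ + b₅aᵢ)`,
`n₅ = 0`, `nᵢ = zᵢ`). Equivalently: the first variation of area along `∇(Φ(z₅) zᵢ)`.
[cite: Hamilton1993, §4] -/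
theorem firstMoment_identity {f νf : M → EuclideanSpace ℝ (Fin 6)}
    (hf : (euclideanMetric (EuclideanSpace ℝ (Fin 6))).IsSpacelikeImmersion (𝓡 4) f)
    (hν : ContMDiff (𝓡 4) 𝓘(ℝ, EuclideanSpace ℝ (Fin 6)) ∞ νf)
    (hun : (euclideanMetric (EuclideanSpace ℝ (Fin 6))).IsUnitNormal (𝓡 4) f νf 1)
    (hN : ∀ x, ∑ i : Fin 5, f x (Fin.castSucc i) ^ 2 = 1)
    (hνN : ∀ x, ∑ i : Fin 5, νf x (Fin.castSucc i) * f x (Fin.castSucc i) = 0)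
    {Φ : ℝ → ℝ} (hΦ : ContDiff ℝ 2 Φ) (i : Fin 5) :
    ∫ w, ((deriv (deriv Φ) (f w 5) * f w (Fin.castSucc i) - 4 * (Φ (f w 5) * f w (Fin.castSucc i)))
        - (deriv (deriv Φ) (f w 5) * νf w 5 ^ 2 * f w (Fin.castSucc i)
            + 2 * (deriv Φ (f w 5) * νf w 5 * νf w (Fin.castSucc i))
            - (∑ l : Fin 5, νf w (Fin.castSucc l) ^ 2) * (Φ (f w 5) * f w (Fin.castSucc i)))
        - (euclideanMetric (EuclideanSpace ℝ (Fin 6))).meanCurvature f contMDiff_pullbackBilin_holds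
            hf νf w * (deriv Φ (f w 5) * νf w 5 * f w (Fin.castSucc i)
              + Φ (f w 5) * νf w (Fin.castSucc i)))
      ∂riemannianMeasure ((euclideanMetric (EuclideanSpace ℝ (Fin 6))).inducedRiemannianMetric f
        contMDiff_pullbackBilin_holds hf) = 0 := by
  -- Green's identity for `φ = (Φ ∘ e₅^*) · eᵢ^*`
  have h0 := integral_sliceLaplacian_eq_zero hf hν hun hN hνN (contDiff_firstMoment hΦ i)
  have hd : Differentiable ℝ Φ := hΦ.differentiable two_ne_zero
  -- the integrand, pointwise (`H`, `S` stand for the mean curvature and `|ν'|²`)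
  have hpt : ∀ (w) (H S : ℝ),
      (((∑ j : Fin 6, iteratedFDeriv ℝ 2
              (fun z : EuclideanSpace ℝ (Fin 6) => Φ (z 5) * z (Fin.castSucc i)) (f w)
              ![EuclideanSpace.single j (1 : ℝ), EuclideanSpace.single j (1 : ℝ)])
            - iteratedFDeriv ℝ 2 (fun z : EuclideanSpace ℝ (Fin 6) => Φ (z 5) * z (Fin.castSucc i))
                (f w) ![padL (truncL (f w)), padL (truncL (f w))]
            - 4 * fderiv ℝ (fun z : EuclideanSpace ℝ (Fin 6) => Φ (z 5) * z (Fin.castSucc i)) (f w)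
                (padL (truncL (f w))))
          - (iteratedFDeriv ℝ 2 (fun z : EuclideanSpace ℝ (Fin 6) => Φ (z 5) * z (Fin.castSucc i))
                (f w) ![νf w, νf w]
            - S * fderiv ℝ (fun z : EuclideanSpace ℝ (Fin 6) => Φ (z 5) * z (Fin.castSucc i)) (f w)
                (padL (truncL (f w))))
          - H * fderiv ℝ (fun z : EuclideanSpace ℝ (Fin 6) => Φ (z 5) * z (Fin.castSucc i)) (f w)
              (νf w))
        = (deriv (deriv Φ) (f w 5) * f w (Fin.castSucc i) - 4 * (Φ (f w 5) * f w (Fin.castSucc i)))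
          - (deriv (deriv Φ) (f w 5) * νf w 5 ^ 2 * f w (Fin.castSucc i)
              + 2 * (deriv Φ (f w 5) * νf w 5 * νf w (Fin.castSucc i))
              - S * (Φ (f w 5) * f w (Fin.castSucc i)))
          - H * (deriv Φ (f w 5) * νf w 5 * f w (Fin.castSucc i)
              + Φ (f w 5) * νf w (Fin.castSucc i)) := by
    intro w H S
    rw [sum_iteratedFDeriv_two_firstMoment_single hΦ, iteratedFDeriv_two_firstMoment hΦ,
      iteratedFDeriv_two_firstMoment hΦ, fderiv_firstMoment_apply hd,
      fderiv_firstMoment_apply hd, padL_apply_last, padL_apply_castSucc, truncL_apply]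
    ring
  exact (integral_congr_ae (Eventually.of_forall fun w => (hpt w _ _).symm)).trans h0

end Identity

/-- **Registered helper `helper_firstMomentIdentity` of line `killing-flux` (a first-variation
identity on closed cross-sections, consumed by the constancy step of the area-quantization
argument).** For a closed immersed cross-section `f : M⁴ → N = S⁴ × ℝ` with smooth unit normal `ν`
tangent to `N`, mean curvature `H` of `(f, ν)`, any `Φ ∈ C²(ℝ)` and `i < 5`:
`∫_M ([Φ''zᵢ - 4Φzᵢ] - [Φ''ν₅²zᵢ + 2Φ'ν₅νᵢ - |ν'|²Φzᵢ] - H[Φ'ν₅zᵢ + Φνᵢ]) dμ_g = 0`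
(`Φ, Φ', Φ''` at `z₅`; `μ_g` the Riemannian measure of `g = f^*δ`; `firstMoment_identity`).
[cite: Hamilton1993, §4] -/
theorem helper_firstMomentIdentity :
    ∀ (M : Type) [TopologicalSpace M] [ChartedSpace (EuclideanSpace ℝ (Fin 4)) M] [IsManifold (𝓡 4) ∞ M] [CompactSpace M] [T2Space M] [MeasurableSpace M] [BorelSpace M] (f νf : M → EuclideanSpace ℝ (Fin 6)) (hf : (Literature.Geometry.Riemannian.euclideanMetric (EuclideanSpace ℝ (Fin 6))).IsSpacelikeImmersion (𝓡 4) f), ContMDiff (𝓡 4) (𝓡 6) ∞ νf → (Literature.Geometry.Riemannian.euclideanMetric (EuclideanSpace ℝ (Fin 6))).IsUnitNormal (𝓡 4) f νf 1 → (∀ x, ∑ i : Fin 5, f x (Fin.castSucc i) ^ 2 = 1) → (∀ x, ∑ i : Fin 5, νf x (Fin.castSucc i) * f x (Fin.castSucc i) = 0) → ∀ (Φ : ℝ → ℝ), ContDiff ℝ 2 Φ → ∀ i : Fin 5, ∫ w, ((deriv (deriv Φ) (f w 5) * f w (Fin.castSucc i) - 4 * (Φ (f w 5) * f w (Fin.castSucc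 i))) - (deriv (deriv Φ) (f w 5) * νf w 5 ^ 2 * f w (Fin.castSucc i) + 2 * (deriv Φ (f w 5) * νf w 5 * νf w (Fin.castSucc i)) - (∑ l : Fin 5, νf w (Fin.castSucc l) ^ 2) * (Φ (f w 5) * f w (Fin.castSucc i))) - (Literature.Geometry.Riemannian.euclideanMetric (EuclideanSpace ℝ (Fin 6))).meanCurvature f Literature.Geometry.Lorentzian.PseudoRiemannianMetric.contMDiff_pullbackBilin_holds hf νf w * (deriv Φ (f w 5) * νf w 5 * f w (Fin.castSucc i) + Φ (f w 5) * νf w (Fin.castSucc i))) ∂Literature.Geometry.Lorentzian.riemannianMeasure ((Literature.Geometry.Riemannian.euclideanMetric (EuclideanSpace ℝ (Fin 6))).inducedRiemannianMetric f Literature.Geometry.Lorentzian.PseudoRiemannianMetric.contMDiff_pullbackBilin_holds hf) = 0 :=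
  fun _ _ _ _ _ _ _ _ _ _ hf hν hun hN hνN _ hΦ i =>
    firstMoment_identity hf hν hun hN hνN hΦ i

end Summit.SmoothPoincare4.SmoothPoincare4.Cruxes.CylinderRungTwo.KillingFlux

end
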